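import Literature.AlgebraicGeometry.Resolution.ExceptionalFibreConnected
import Literature.AlgebraicGeometry.Resolution.RegularLocalRingsNormal
import Literature.AlgebraicGeometry.Morphisms.CechH1AffineProofs
import HarnessLib

/-!
# A resolution of a surface singularity without exceptional curves is an isomorphism; `H¹ = 0`

Topic: `Literature/AlgebraicGeometry/Resolution`. Brick (E) of the sub-cell «(1.2) 2-reg» of the D-0154 (2)
RES inputs cell (planner skeleton `F79_2reg_BRICKS_SKELETON.lean`, `stub_base`), the BASE CASE of the induction
on the number of exceptional curves: for `T` a two-dimensional Noetherian local normal domain and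
`π : X → Spec T` a resolution (`IsResolution`: proper birational, `X` regular),

* `IsResolution.closedFibre_subsingleton_of_excCurvePoints_eq_empty` — if `π` has NO integral exceptional
  curve (`excCurvePoints π = ∅`), the closed fibre is a single point: it is connected (Zariski,
  `IsResolution.isPreconnected_closedFibre`), its finitely many maximal points are closed, and the closures
  of two distinct ones would disconnect it (the argument of `IsResolution.exists_mem_excCurvePoints_specializes`
  with "`T` not regular" replaced by "no exceptional curve");
* `IsResolution.isIso_of_closedFibre_subsingleton` — a resolution with a one-point closed fibre IS AN
  ISOMORPHISM (every point specialises into the closed fibre, so `X` is affine, `π` is finite birational onto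
  the normal `Spec T`, Stacks 0AB1; the argument of `IsResolution.isRegularLocalRing_of_closedFibre_subsingleton`,
  which records only the consequence "`T` regular");
* `HasTrivialCechH1.of_isAffine` — `H¹ = 0` on an affine scheme (`cechH1_affine_vanishing_holds`);
* `hasTrivialCechH1_of_isResolution_of_excCurvePoints_eq_empty` — **for `T` REGULAR of dimension `2`: a
  resolution without exceptional curves has `H¹(X, 𝒪_X) = 0`** (Lipman, Def. (1.1): "if `R` is regular then
  `R` has a rational singularity (take `X = Spec(R)`)" — here `X ≅ Spec R` is forced).

No definitions, no named facts; Lipman's Prop. (1.2) itself is NOT proved here.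

## Sources

* J. Lipman, Publ. Math. IHÉS 36 (1969), Def. (1.1) and Prop. (1.2) (p. 199), §10 (p. 212). [Lipman1969]
* The Stacks Project, Tag 0AB1 (finite birational onto normal is an isomorphism), Tag 03H0 (Zariski's
  connectedness), Tag 01XD (Čech cohomology of affines). [StacksProject]
-/

noncomputable section

open CategoryTheory CategoryTheory.Limits AlgebraicGeometry TopologicalSpace Topology IsLocalRing
open Literature.AlgebraicGeometry.Morphisms

universe u

namespace Literature.AlgebraicGeometry.Resolution

/-! ## `H¹ = 0` on affine schemes -/

/-- **An affine scheme has `H¹(X, 𝒪_X) = 0`** (`HasTrivialCechH1` form: `Ȟ¹(𝒱, 𝒪_X) = 0` for every finite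
affine open cover `𝒱`; the tree's `cechH1_affine_vanishing_holds`, Görtz–Wedhorn I Prop. 12.32).
[cite: StacksProject, Tag 01XD (Cohomology of Schemes, Lemma 30.2.6)] -/
theorem HasTrivialCechH1.of_isAffine {A : Type u} [CommRing A] {X : Scheme.{u}} [IsAffine X]
    (f : X ⟶ Spec (.of A)) : HasTrivialCechH1 f := by
  intro ι _ U _ hU
  rw [Submodule.Quotient.subsingleton_iff, eq_top_iff]
  rintro z -
  exact cechH1_affine_vanishing_holds f (isAffineOpen_top X) U hU z.2

section Resolution

variable {T : Type u} [CommRing T] [IsDomain T] [IsNoetherianRing T] [IsLocalRing T]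
  {X : Scheme.{u}} {π : X ⟶ Spec (.of T)}

omit [IsNoetherianRing T] [IsLocalRing T] in
/-- The local rings of `Spec T`, `T` a normal domain, are integrally closed. [folklore] -/
private theorem isIntegrallyClosed_stalk_Spec (hT : IsIntegrallyClosed T) (y : Spec (.of T)) :
    IsIntegrallyClosed ((Spec (.of T)).presheaf.stalk y) := by
  letI : Algebra T ((Spec (.of T)).presheaf.stalk y) :=
    inferInstanceAs (Algebra T ((Spec.structureSheaf T).presheaf.stalk y))
  haveI : IsLocalization.AtPrime ((Spec (.of T)).presheaf.stalk y) y.asIdeal :=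
    StructureSheaf.IsLocalization.to_stalk T y
  haveI := hT
  exact isIntegrallyClosed_of_isLocalization _ y.asIdeal.primeCompl
    (Ideal.primeCompl_le_nonZeroDivisors _)

omit [IsDomain T] [IsNoetherianRing T] in
/-- Over a local base, every point of a proper `X → Spec T` specialises to a point of the closed fibre.
[folklore] -/
private theorem exists_specializes_mem_closedFibre [IsProper π] (x : X) :
    ∃ c : X, x ⤳ c ∧ π.base c = closedPoint T := by
  haveI : CompactSpace X := QuasiCompact.compactSpace_of_compactSpace π
  obtain ⟨c, hc, hccl⟩ := (isClosed_closure (s := ({x} : Set X))).exists_closed_singleton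
    ⟨x, subset_closure rfl⟩
  refine ⟨c, specializes_iff_mem_closure.mpr hc, ?_⟩
  have himg : IsClosed ({π.base c} : Set (Spec (.of T))) := by
    have := π.isClosedMap _ hccl
    rwa [Set.image_singleton] at this
  have hmax := (PrimeSpectrum.isClosed_singleton_iff_isMaximal (π.base c)).mp himg
  exact PrimeSpectrum.ext (IsLocalRing.eq_maximalIdeal hmax)

/-- **No exceptional curve ⇒ the closed fibre is a single point.** For `T` a two-dimensional Noetherian
local normal domain and `π : X → Spec T` a resolution with `excCurvePoints π = ∅`, the closed fibre
`π⁻¹(𝔪)` has at most one point: a maximal point `η` of the (connected, Zariski) closed fibre `E` is closed,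
since it is not an exceptional curve point (`IsResolution.mem_excCurvePoints_iff`); then `{η}` and the union
of the closures of the other maximal points are disjoint closed sets covering `E`, so `E = {η}`.
[cite: Lipman1969, Section 10 (p. 212)] [cite: StacksProject, Tag 03H0] -/
theorem IsResolution.closedFibre_subsingleton_of_excCurvePoints_eq_empty [IsIntegrallyClosed T]
    (h2 : ringKrullDim T = 2) (hπ : IsResolution π) (h0 : excCurvePoints π = ∅) :
    (π.base ⁻¹' {closedPoint T}).Subsingleton := by
  haveI : IsProper π := hπ.isProper
  set E : Set X := π.base ⁻¹' {closedPoint T} with hEdef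
  have hE : IsClosed E := (isClosed_singleton_closedPoint T).preimage π.continuous
  -- every maximal point of `E` is closed
  have hcl : ∀ η ∈ excPoints π, IsClosed ({η} : Set X) := fun η hη => by
    by_contra hncl
    have hmem : η ∈ excCurvePoints π := (hπ.mem_excCurvePoints_iff h2).2 ⟨hη, hncl⟩
    rw [h0] at hmem
    exact hmem
  intro x hx z hz
  obtain ⟨η, hηmax, hηx⟩ := exists_mem_maxPoints_specializes hE hx
  have hηexc : η ∈ excPoints π := hηmax
  -- the other components of the closed fibre
  set F : Set X := ⋃ η' ∈ excPoints π \ {η}, closure {η'} with hFdef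
  have hF : IsClosed F :=
    ((excPoints_finite π).subset fun _ h => h.1).isClosed_biUnion fun _ _ => isClosed_closure
  have hEsub : E ⊆ {η} ∪ F := fun w hw => by
    obtain ⟨η', hη'max, hη'w⟩ := exists_mem_maxPoints_specializes hE hw
    by_cases hη'η : η' = η
    · subst hη'η
      left
      exact (hcl _ hη'max).closure_subset (specializes_iff_mem_closure.mp hη'w)
    · right
      exact Set.mem_biUnion (show η' ∈ excPoints π \ {η} from ⟨hη'max, hη'η⟩)
        (specializes_iff_mem_closure.mp hη'w)
  have hdisj : ∀ w ∈ E, w ∈ ({η} : Set X) → w ∈ F → False := by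
    rintro w - rfl hwF
    obtain ⟨η', hη', hwη'⟩ := Set.mem_iUnion₂.mp hwF
    have hsp : η' ⤳ w := specializes_iff_mem_closure.mpr hwη'
    exact hη'.2 (hηmax.2 η' hη'.1.1 hsp)
  have hEη : E ⊆ {η} := fun w hw => by
    rcases hEsub hw with h | h
    · exact h
    · exfalso
      have hne : (E ∩ {η}).Nonempty := ⟨η, hηexc.1, rfl⟩
      obtain ⟨w', hw'E, hw'η, hw'F⟩ := (isPreconnected_closed_iff.mp (hπ.isPreconnected_closedFibre))
        {η} F (hcl _ hηexc) hF hEsub hne ⟨w, hw, h⟩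
      exact hdisj w' hw'E hw'η hw'F
  exact (Set.subsingleton_singleton.anti hEη) hx hz

omit [IsNoetherianRing T] in
/-- **A resolution with a one-point closed fibre is an isomorphism** (`T` a Noetherian local normal domain):
every point of `X` specialises into the closed fibre `{η}`, so an affine neighbourhood of `η` is all of `X`;
then `π` is affine and proper, i.e. finite, and a finite birational morphism onto the normal `Spec T` is an
isomorphism (Stacks 0AB1; the argument of `IsResolution.isRegularLocalRing_of_closedFibre_subsingleton`).
[cite: StacksProject, Tag 0AB1] -/
theorem IsResolution.isIso_of_closedFibre_subsingleton [IsIntegrallyClosed T]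
    (hπ : IsResolution π) (hsub : (π.base ⁻¹' {closedPoint T}).Subsingleton) : IsIso π := by
  haveI : IsProper π := hπ.isProper
  haveI : IsIntegral X := hπ.isIntegral_source
  obtain ⟨x₀⟩ := (inferInstance : Nonempty X)
  obtain ⟨η, -, hη⟩ := exists_specializes_mem_closedFibre (π := π) x₀
  have hall : ∀ x : X, x ⤳ η := fun x => by
    obtain ⟨c, hxc, hc⟩ := exists_specializes_mem_closedFibre (π := π) x
    have : c = η := hsub hc hη
    rwa [this] at hxc
  obtain ⟨U, hU, hηU, -⟩ :=
    exists_isAffineOpen_mem_and_subset (X := X) (x := η) (U := ⊤) (Opens.mem_top _)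
  have hUtop : U = ⊤ := by
    ext x
    simp only [Opens.coe_top, Set.mem_univ, iff_true]
    exact (hall x).mem_open U.isOpen hηU
  subst hUtop
  haveI : IsAffine (⊤ : X.Opens) := hU
  haveI : IsAffine X := IsAffine.of_isIso X.topIso.inv
  haveI : IsAffineHom π := inferInstance
  haveI : IsFinite π := IsFinite.iff_isProper_and_isAffineHom.mpr ⟨inferInstance, inferInstance⟩
  exact isIso_of_isFinite_of_isBirational π (isIntegrallyClosed_stalk_Spec inferInstance)
    hπ.isBirational

end Resolution

/-- **A resolution of a two-dimensional regular local ring without exceptional curves has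
`H¹(X, 𝒪_X) = 0`** (the base case of Lipman (1.2) 2) for a regular base): the closed fibre is a point, so
`π` is an isomorphism and `X ≅ Spec T` is affine. [cite: Lipman1969, Definition (1.1) (p. 199)]
[cite: StacksProject, Tag 0AB1] -/
theorem hasTrivialCechH1_of_isResolution_of_excCurvePoints_eq_empty {T : Type u} [CommRing T]
    [IsRegularLocalRing T] (hT : ringKrullDim T = 2)
    {X : Scheme.{u}} (π : X ⟶ Spec (.of T)) (hπ : IsResolution π)
    (h0 : excCurvePoints π = ∅) : HasTrivialCechH1 π := by
  haveI := isDomain_of_isRegularLocalRing T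
  haveI : IsIntegrallyClosed T := isIntegrallyClosed_of_isRegularLocalRing T
  haveI : IsIso π := hπ.isIso_of_closedFibre_subsingleton
    (hπ.closedFibre_subsingleton_of_excCurvePoints_eq_empty hT h0)
  haveI : IsAffine X := IsAffine.of_isIso π
  exact HasTrivialCechH1.of_isAffine π

end Literature.AlgebraicGeometry.Resolution

end
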